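import Literature.IUT.HodgeArakelov.CohomologyAutEquiv

/-!
# Functoriality of `autMap` in the automorphism pair, and invertibility on `H¹(H, A)` itself

Proof-only companion (abc-iut cell, WAVE-5 seat abc-iut-w5-d072; no definitions, no Prop-valued facts) to
abc-iut-L6-t1's `CohomologyAutFunctoriality.lean` (p412635) and `CohomologyAutEquiv.lean` (p412842). The latter
makes the LIMIT action `h1LimAut` an additive automorphism (`h1LimAutEquiv : lim ≃+ lim`). GAP row G-w4d010-2 (a)
of the cell's GAP-LEDGER also names the action on `H1 ⊤` itself, `ρ : H1 ⊤ ≃+ H1 ⊤`, together with the square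
`toLim ∘ ρ = ρlim ∘ toLim` (the action of a pointed inversion `ι` on `H¹(Π_Ÿ(Π), (l·Δ_Θ)(Π))`; S. Mochizuki,
*Inter-universal Teichmüller theory II*, kurims manuscript (Dec. 2020), Prop. 1.4 p. 27, Cor. 1.12 (i) p. 57
l. 9–10 «induces an “action up to torsion”», Prop. 2.2 (ii) p. 66 l. 54–55 «the condition of invariance with
respect to ι»). This file supplies the remaining, non-duplicated pieces:
* FUNCTORIALITY of `ContH1Aut.autMap` in the pair: composition `autMap_trans` (with `autCocycle_trans`), the
  identity pair acts by restriction `autMap_refl` (with `autCocycle_refl`), and `autMap_congr`;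
* the other-order inverse law `autMap_autMap_symm` and `autMap_bijective` (for `α(H₁) = H₂`, `β(A) = A`);
* on `H¹(H ⊓ ⊤, A)`: `h1TopAut_symm_h1TopAut`, `h1TopAut_h1TopAut_symm`, `h1TopAut_bijective` — so `ρ` at the
  model is `MulEquiv.ofBijective (h1TopAut …) (h1TopAut_bijective …)` (conjugated by `h1EquivOfFiniteIndexOpen`),
  its underlying map being `h1TopAut`, for which p412635's square `toLim_h1TopAut` holds verbatim.
Transport of structure in group cohomology: [NSW] I §5. Nothing of [IUTchII] is asserted (claim key of the
interface `Mochizuki2012`, disputed); no side is taken on [IUTchIII] Cor. 3.12.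
-/

namespace Literature.IUT.HodgeArakelov

open Literature.AnabelianGeometry.EtaleTheta CohomologySystemOfContH1

universe u

noncomputable section

namespace ContH1Aut

variable {G : Type u} {G' : Type u} [Group G] [TopologicalSpace G]
  [Group G'] [TopologicalSpace G'] [IsTopologicalGroup G']
  (φ : G →* G') (A : Subgroup G') [A.Normal] [IsMulCommutative A]

omit [IsTopologicalGroup G'] [A.Normal] [IsMulCommutative A] in
/-- If `β(A) = A` then also `β⁻¹(A) = A` (iff form, ready to feed the `(α⁻¹, β⁻¹)` instance of the lemmas of
`CohomologyAutEquiv`). [cite: NeukirchSchmidtWingberg2008, I §5] -/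
theorem mem_iff_symm (β : G' ≃ₜ* G') (hA : ∀ a : G', a ∈ A ↔ β a ∈ A) (a : G') : a ∈ A ↔ β.symm a ∈ A := by
  rw [hA (β.symm a), ContinuousMulEquiv.apply_symm_apply]

/-- `autMap` depends on the pair `(α, β)` only (the proof arguments are irrelevant): a congruence lemma for
rewriting the pair. [cite: NeukirchSchmidtWingberg2008, I §5] -/
theorem autMap_congr {α α' : G ≃ₜ* G} {β β' : G' ≃ₜ* G'} (hα : α = α') (hβ : β = β')
    (hφ : ∀ g, β (φ g) = φ (α g)) (hφ' : ∀ g, β' (φ g) = φ (α' g))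
    (hA : ∀ a : G', a ∈ A → β a ∈ A) (hA' : ∀ a : G', a ∈ A → β' a ∈ A)
    {H H' : Subgroup G} (hH : ∀ x, x ∈ H' → α.symm x ∈ H) (hH' : ∀ x, x ∈ H' → α'.symm x ∈ H)
    (x : ContH1 φ A H) :
    autMap φ A α β hφ hA hH x = autMap φ A α' β' hφ' hA' hH' x := by
  subst hα hβ
  rfl

/-- FUNCTORIALITY of cocycle transport: transporting along `(α₁, β₁)` and then along `(α₂, β₂)` is
transporting along the composite pair `(α₂ ∘ α₁, β₂ ∘ β₁)`. [cite: NeukirchSchmidtWingberg2008, I §5] -/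
theorem autCocycle_trans (α₁ α₂ : G ≃ₜ* G) (β₁ β₂ : G' ≃ₜ* G')
    (hφ₁ : ∀ g, β₁ (φ g) = φ (α₁ g)) (hφ₂ : ∀ g, β₂ (φ g) = φ (α₂ g))
    (hφ₁₂ : ∀ g, (β₁.trans β₂) (φ g) = φ ((α₁.trans α₂) g))
    (hA₁ : ∀ a : G', a ∈ A → β₁ a ∈ A) (hA₂ : ∀ a : G', a ∈ A → β₂ a ∈ A)
    (hA₁₂ : ∀ a : G', a ∈ A → (β₁.trans β₂) a ∈ A)
    {H₁ H₂ H₃ : Subgroup G} (hH₁ : ∀ x, x ∈ H₂ → α₁.symm x ∈ H₁) (hH₂ : ∀ x, x ∈ H₃ → α₂.symm x ∈ H₂)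
    (hH₁₂ : ∀ x, x ∈ H₃ → (α₁.trans α₂).symm x ∈ H₁) (f : contCocycles φ A H₁) :
    autCocycle φ A α₂ β₂ hφ₂ hA₂ hH₂ (autCocycle φ A α₁ β₁ hφ₁ hA₁ hH₁ f) =
      autCocycle φ A (α₁.trans α₂) (β₁.trans β₂) hφ₁₂ hA₁₂ hH₁₂ f := by
  apply Subtype.ext; funext x; apply Subtype.ext
  rw [coe_autCocycle_apply, coe_autCocycle_apply, coe_autCocycle_apply]
  rfl

/-- FUNCTORIALITY of `autMap : H¹(H₁, A) → H¹(H₂, A) → H¹(H₃, A)`: `autMap (α₂, β₂) ∘ autMap (α₁, β₁) =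
autMap (α₂ ∘ α₁, β₂ ∘ β₁)`. [cite: NeukirchSchmidtWingberg2008, I §5] -/
theorem autMap_trans (α₁ α₂ : G ≃ₜ* G) (β₁ β₂ : G' ≃ₜ* G')
    (hφ₁ : ∀ g, β₁ (φ g) = φ (α₁ g)) (hφ₂ : ∀ g, β₂ (φ g) = φ (α₂ g))
    (hφ₁₂ : ∀ g, (β₁.trans β₂) (φ g) = φ ((α₁.trans α₂) g))
    (hA₁ : ∀ a : G', a ∈ A → β₁ a ∈ A) (hA₂ : ∀ a : G', a ∈ A → β₂ a ∈ A)
    (hA₁₂ : ∀ a : G', a ∈ A → (β₁.trans β₂) a ∈ A)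
    {H₁ H₂ H₃ : Subgroup G} (hH₁ : ∀ x, x ∈ H₂ → α₁.symm x ∈ H₁) (hH₂ : ∀ x, x ∈ H₃ → α₂.symm x ∈ H₂)
    (hH₁₂ : ∀ x, x ∈ H₃ → (α₁.trans α₂).symm x ∈ H₁) (x : ContH1 φ A H₁) :
    autMap φ A α₂ β₂ hφ₂ hA₂ hH₂ (autMap φ A α₁ β₁ hφ₁ hA₁ hH₁ x) =
      autMap φ A (α₁.trans α₂) (β₁.trans β₂) hφ₁₂ hA₁₂ hH₁₂ x := by
  induction x using QuotientGroup.induction_on with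
  | H f =>
    exact congrArg (fun c : contCocycles φ A H₃ => (QuotientGroup.mk c : ContH1 φ A H₃))
      (autCocycle_trans φ A α₁ α₂ β₁ β₂ hφ₁ hφ₂ hφ₁₂ hA₁ hA₂ hA₁₂ hH₁ hH₂ hH₁₂ f)

/-- The IDENTITY pair transports cocycles by restriction: `autCocycle (refl, refl) = resCocycle` along
`H' ≤ H`. [cite: NeukirchSchmidtWingberg2008, I §5] -/
theorem autCocycle_refl (hφ : ∀ g, (ContinuousMulEquiv.refl G') (φ g) = φ ((ContinuousMulEquiv.refl G) g))
    (hA : ∀ a : G', a ∈ A → (ContinuousMulEquiv.refl G') a ∈ A)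
    {H H' : Subgroup G} (h : H' ≤ H) (hH : ∀ x, x ∈ H' → (ContinuousMulEquiv.refl G).symm x ∈ H)
    (f : contCocycles φ A H) :
    autCocycle φ A (ContinuousMulEquiv.refl G) (ContinuousMulEquiv.refl G') hφ hA hH f =
      ContH1.resCocycle φ A h f := by
  apply Subtype.ext; funext x; apply Subtype.ext
  rw [coe_autCocycle_apply]
  rfl

/-- The IDENTITY pair acts on `H¹` by restriction: `autMap (refl, refl) = res` along `H' ≤ H` (in particular
it is the identity for `H' = H`, cf. `res_self_apply`). [cite: NeukirchSchmidtWingberg2008, I §5] -/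
theorem autMap_refl (hφ : ∀ g, (ContinuousMulEquiv.refl G') (φ g) = φ ((ContinuousMulEquiv.refl G) g))
    (hA : ∀ a : G', a ∈ A → (ContinuousMulEquiv.refl G') a ∈ A)
    {H H' : Subgroup G} (h : H' ≤ H) (hH : ∀ x, x ∈ H' → (ContinuousMulEquiv.refl G).symm x ∈ H)
    (x : ContH1 φ A H) :
    autMap φ A (ContinuousMulEquiv.refl G) (ContinuousMulEquiv.refl G') hφ hA hH x = ContH1.res φ A h x := by
  induction x using QuotientGroup.induction_on with
  | H f =>
    exact congrArg (fun c : contCocycles φ A H' => (QuotientGroup.mk c : ContH1 φ A H'))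
      (autCocycle_refl φ A hφ hA h hH f)

/-- Restriction along `H ≤ H` is the identity of `H¹(H, A)` (general topological group `G`; the
`TopGroup` version is `CohomologySystemOfContH1.res_refl_apply`). [cite: NeukirchSchmidtWingberg2008, I §5] -/
theorem res_self_apply {H : Subgroup G} (x : ContH1 φ A H) : ContH1.res φ A (le_refl H) x = x := by
  induction x using QuotientGroup.induction_on with
  | H f => rfl

/-- The inverse law in the OTHER order: `autMap (α, β) (autMap (α⁻¹, β⁻¹) x) = res x` along `H'' ≤ H`
(the `(α⁻¹, β⁻¹)` instance of `autMap_symm_autMap`). [cite: NeukirchSchmidtWingberg2008, I §5] -/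
theorem autMap_autMap_symm (α : G ≃ₜ* G) (β : G' ≃ₜ* G') (hφ : ∀ g, β (φ g) = φ (α g))
    (hA : ∀ a : G', a ∈ A ↔ β a ∈ A) {H H' H'' : Subgroup G} (hH : ∀ x, x ∈ H' → α.symm.symm x ∈ H)
    (hH' : ∀ x, x ∈ H'' → α.symm x ∈ H') (hle : H'' ≤ H) (x : ContH1 φ A H) :
    autMap φ A α β hφ (fun a ha => (hA a).mp ha) hH'
      (autMap φ A α.symm β.symm (compat_symm φ α β hφ) (mem_symm A β hA) hH x) = ContH1.res φ A hle x :=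
  autMap_symm_autMap φ A α.symm β.symm (compat_symm φ α β hφ) (mem_iff_symm A β hA) hH hH' hle x

/-- **`autMap` is BIJECTIVE** for an automorphism pair with `β(A) = A`, from `H¹(H₁, A)` onto `H¹(H₂, A)`
whenever `α(H₁) = H₂` (two-sided inverse: `autMap` of the inverse pair). [cite: NeukirchSchmidtWingberg2008, I §5] -/
theorem autMap_bijective (α : G ≃ₜ* G) (β : G' ≃ₜ* G') (hφ : ∀ g, β (φ g) = φ (α g))
    (hA : ∀ a : G', a ∈ A ↔ β a ∈ A) (hA' : ∀ a : G', a ∈ A → β a ∈ A)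
    {H₁ H₂ : Subgroup G} (hH₁ : ∀ x, x ∈ H₂ → α.symm x ∈ H₁) (hH₂ : ∀ x, x ∈ H₁ → α x ∈ H₂) :
    Function.Bijective (autMap φ A α β hφ hA' hH₁) := by
  have hH₂' : ∀ x, x ∈ H₁ → α.symm.symm x ∈ H₂ := hH₂
  exact Function.bijective_iff_has_inverse.mpr
    ⟨autMap φ A α.symm β.symm (compat_symm φ α β hφ) (mem_symm A β hA) hH₂',
      fun x => (autMap_symm_autMap φ A α β hφ hA hH₁ hH₂' le_rfl x).trans (res_self_apply φ A x),
      fun y => (autMap_autMap_symm φ A α β hφ hA hH₂' hH₁ le_rfl y).trans (res_self_apply φ A y)⟩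

end ContH1Aut

/-! ## On `H¹(H ⊓ ⊤, A)` (the system's `H1 ⊤` up to `h1EquivOfFiniteIndexOpen`): inverting `h1TopAut` -/

section Top

variable {P : TopGroup.{u}} {G' : Type u} [Group G'] [TopologicalSpace G'] [IsTopologicalGroup G']
  (φ : P →* G') (A : Subgroup G') [A.Normal] [IsMulCommutative A] (H : Subgroup P)
  (α : P ≃ₜ* P) (β : G' ≃ₜ* G') (hφ : ∀ g, β (φ g) = φ (α g))
  (hA' : ∀ a : G', a ∈ A → β a ∈ A) (hH : ∀ x, x ∈ H ↔ α x ∈ H)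

/-- **The inverse pair undoes `h1TopAut`** on `H¹(H ⊓ ⊤, A)`: `h1TopAut (α⁻¹, β⁻¹) (h1TopAut (α, β) x) = x`.
[cite: Mochizuki2012, Cor 1.12 (i) p.57] -/
theorem h1TopAut_symm_h1TopAut (hA : ∀ a : G', a ∈ A ↔ β a ∈ A) (x : ContH1 φ A (H ⊓ ⊤)) :
    h1TopAut φ A H α.symm β.symm (ContH1Aut.compat_symm φ α β hφ) (ContH1Aut.mem_symm A β hA)
      (stab_symm H α hH) (h1TopAut φ A H α β hφ hA' hH x) = x :=
  (ContH1Aut.autMap_symm_autMap φ A α β hφ hA (symm_mem_inf_top H α hH)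
      (symm_mem_inf_top H α.symm (stab_symm H α hH)) le_rfl x).trans
    (CohomologySystemOfContH1.res_refl_apply φ A x)

/-- **The inverse pair undoes `h1TopAut`**, other order: `h1TopAut (α, β) (h1TopAut (α⁻¹, β⁻¹) x) = x`.
[cite: Mochizuki2012, Cor 1.12 (i) p.57] -/
theorem h1TopAut_h1TopAut_symm (hA : ∀ a : G', a ∈ A ↔ β a ∈ A) (x : ContH1 φ A (H ⊓ ⊤)) :
    h1TopAut φ A H α β hφ hA' hH (h1TopAut φ A H α.symm β.symm (ContH1Aut.compat_symm φ α β hφ)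
      (ContH1Aut.mem_symm A β hA) (stab_symm H α hH) x) = x :=
  (ContH1Aut.autMap_autMap_symm φ A α β hφ hA (symm_mem_inf_top H α.symm (stab_symm H α hH))
      (symm_mem_inf_top H α hH) le_rfl x).trans
    (CohomologySystemOfContH1.res_refl_apply φ A x)

/-- **`h1TopAut` is BIJECTIVE** for an automorphism pair with `β(A) = A`, `α(H) = H`: the GAP row's
`ρ : H1 ⊤ ≃+ H1 ⊤` at the model is (the `h1EquivOfFiniteIndexOpen`-conjugate of) `MulEquiv.ofBijective
(h1TopAut …) (h1TopAut_bijective …)`, whose underlying map is `h1TopAut`, so that p412635's square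
`toLim_h1TopAut` and p412842's `h1LimAutEquiv` give `toLim ∘ ρ = ρlim ∘ toLim`. [cite: Mochizuki2012, Cor 1.12 (i) p.57] -/
theorem h1TopAut_bijective (hA : ∀ a : G', a ∈ A ↔ β a ∈ A) :
    Function.Bijective (h1TopAut φ A H α β hφ hA' hH) :=
  Function.bijective_iff_has_inverse.mpr
    ⟨h1TopAut φ A H α.symm β.symm (ContH1Aut.compat_symm φ α β hφ) (ContH1Aut.mem_symm A β hA)
        (stab_symm H α hH),
      h1TopAut_symm_h1TopAut φ A H α β hφ hA' hH hA, h1TopAut_h1TopAut_symm φ A H α β hφ hA' hH hA⟩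

end Top

end

end Literature.IUT.HodgeArakelov
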